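import Summits.BirchSwinnertonDyer.BirchSwinnertonDyer.Theorems.ErratumRoadFiveControlFromJSWMult
import Summits.BirchSwinnertonDyer.BirchSwinnertonDyer.Theorems.ClassRecordThreeNormRigidityOneSided
import Summits.BirchSwinnertonDyer.Rank1Residual.X11b.RouteR1BDPValue
import Summits.BirchSwinnertonDyer.Rank1Residual.X11b.RouteR1BDPExists
import Summits.BirchSwinnertonDyer.Rank1Residual.X11b.CastellaErratumHeegner
import Summits.BirchSwinnertonDyer.Rank1Residual.X11b.EmbeddingDatumPrime
import Summits.BirchSwinnertonDyer.Rank1Residual.X11b.Three.StepLHalves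
import Literature.NumberTheory.EllipticCurves.BDPValueContinuityMultiplicativePrime
import HarnessLib

/-!
# Route `ErratumRoadFive` (K2 at `p ≥ 5`) — the KERNEL-LEVEL form (no route-file import) of
# «crux 19061 `OpenInputIMC` from PRINT + H3♭ + REST‴ + ¬(ram)», for the planner's D4 re-glue

Cell `bsd-stepL` (run/shared/lean/pub/bsd-stepL/), seat `bsd-stepL-bdp` (prover g11, 2026-08-26),
`--supports stmt-BirchSwinnertonDyer-19061` (helper). PLANNER D4 PREREQUISITE (plan g25, `HOME/plan/D4/README.md`,
STATUS 10:37:32Z): the route file's `closes` cannot cite a Theorems module that imports the route file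
(cycle), so the landed chain — imc-p1 g3's `openInputIMC_of_core_of_castella2018Exceptional_of_rest3_of_notRam`
(p437572) over bdp g11's p433271 ∕ p435482 — is RE-PROVED here importing ONLY modules that do not import
`Theses/ErratumRoadFive.lean` (checked transitively: `ErratumRoadFiveControlFromJSWMult` →
`ErratumRoadFiveOpenInputIMCOneSided` → X11b library; `ClassRecordThreeNormRigidityOneSided`; Literature), with
every ROUTE decl UNFOLDED to its body. Sub-namespace `Theorems.KernelFromPrint`; the pair-level steps of p433271 ∕ p435482 ∕ p437572 are INLINED as
`have`s (their home modules import the route file; the gate's dedup rule forbids restating them as theorems).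

## The theorem (argument order = the planner's `Closes-D4-K2.template.lean`)

`KernelFromPrint.openInputIMCBody_of_print_of_core_of_rest3_of_notRam
   (hVN : castella2018Exceptional_bdpValueContinuity_trivialChar)      -- (VN_p), PUBLISHED (p434741)
   (h3  : ∀ W p, P2.IMCDivIntCoreFrameAtErratumData W p)                -- body of 19270 (H3♭, PREPRINT-derived)
   (hF  : <body of 19283 PublishedInputsIMCReduction, 16 conjuncts>)   -- published + cited facts
   (hWu : Wuthrich2014.sha_dvd_analyticSha)                            -- body of 19285
   (h331 : JetchevSkinnerWan2017.thm331_anticyclotomicControl_mult)    -- PUBLISHED (p428223)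
   (hrest : REST‴)                                                      -- imc-p1's residual, verbatim (ℕ-divisibility)
   (hOff : ∀ W p, ¬ Ram W p → P2OpenInputOnTreeAt W p)                  -- body of 19282
   : ∀ W p, P2OpenInputOnTreeAt W p`                                    -- body of 19061
and `…_intCast` with REST‴ spelled with `(p : ℤ) ∣ ↑(padicValInt q Δ_min)` (the spelling of
`plan/D4/edit-D4-K2.json`; equivalent by `Int.natCast_dvd_natCast`).

Proof per pair: ¬(ram) → `hOff`; (ram) without an odd non-split witness ∧ (iv) → `hrest`; (ram) with
`q` odd non-split `E[p]`-ramified and (iv): (VN_p) at the erratum data from the fact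
(inlined `have hVNW`: binder bookkeeping — `ErratumHypotheses` ⇒
`5 ≤ p`, `Mult p`; `Cas20Standing` ⇒ `d_K` odd, `< −3`; `IsErratumField` ⇒ `p` split, Heeg, the sign
clause via `not_dvd_discr_of_splitsIn`; `𝔭_{ι'}` compatible), TARGET E from the core by one-sided NORM
rigidity (`KernelFromPrint.imcDivIntFrameAtErratumData_of_normContinuity_of_core`, thmc-p1 p427664), the
lower half of `BSD(E,p)` by imc-p1's `missingLowerBoundAt_of_erratumHypotheses_of_imcDivIntFrameAtErratumData`
(Wuthrich Prop. 21 for the twist; NO second ramified prime), control at classical data by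
`p2ControlOnTreeAt_of_thm331Mult`, and the open input by one-sided tightness
`openInputOnTreeAt_of_missingLowerBoundAt_of_ram`. HONEST FRAMING: re-plumbing of landed theorems; CONDITIONAL
on the two published facts, H3♭, REST‴ and the ¬(ram) input; nothing is booked; no pair of class X11b is
closed; no label or census count moves (T7).
-/

set_option autoImplicit false

noncomputable section

open scoped Classical Topology
open Filter WeierstrassCurve NumberField IsDedekindDomain Field PowerSeries
open Literature.NumberTheory.EllipticCurves Literature.NumberTheory.EllipticCurves.GreenbergSelmer
open Literature.NumberTheory.EllipticCurves.ModularForms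
open Literature.NumberTheory.EllipticCurves.Rank1Residual
open Literature.NumberTheory.EllipticCurves.Rank1Residual.Typed
open Literature.NumberTheory.EllipticCurves.Wuthrich2014
open Literature.NumberTheory.EllipticCurves.Castella2018
open Literature.NumberTheory.EllipticCurves.JetchevSkinnerWan2017
open Literature.NumberTheory.GaloisRepresentations
open Literature.NumberTheory.GaloisCohomology
open Summit.BirchSwinnertonDyer.Rank1Residual Summit.BirchSwinnertonDyer.Rank1Residual.X11b
open Summit.BirchSwinnertonDyer.Rank1Residual.X11b.Halves

namespace Summit.BirchSwinnertonDyer.BirchSwinnertonDyer.Theorems.KernelFromPrint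

/-! ### §1 Pair level (the kernel-import twins of p433271 §1 and p435482 §1) -/

section Pair

variable {W : WeierstrassCurve ℚ} [W.IsElliptic] [W.IsGloballyMinimal] {p : ℕ} [Fact p.Prime]

/-- **TARGET E from the value-free core + (VN_p) at the erratum data of `(W,p)`** (kernel-import twin of
p433271's `imcDivIntFrameAtErratumData_of_normContinuity_of_core`; proof verbatim: one-sided norm rigidity
at the ♭-frame the core supplies, `u := [T⁰]Q/((1 − a_p p⁻¹)·log_{ω_E} P)²`). CONDITIONAL on both
hypotheses. [claim: Castella2018Erratum, status: under-review]
[cite: Castella2018, Thm. 3.1, display (3.2) and Thm. 3.2 (arXiv:1704.06608 p. 9) (shapes only)] -/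
theorem imcDivIntFrameAtErratumData_of_normContinuity_of_core
    (hVN : ∀ [NeZero (W.conductorNorm ℤ)] (q : ℕ) [Fact q.Prime] (K : Type) [Field K] [NumberField K]
      (Dt : ModularParametrizationData W (W.conductorNorm ℤ))
      (H : HeegnerDatum (W.conductorNorm ℤ) (NumberField.discr K)) (w₀ : InfinitePlace K)
      (P : (W.baseChange K).toAffine.Point), ErratumHypotheses W p → W.analyticRank = 1 →
      q ≠ p → Mult W q → ¬ W.HasSplitMultiplicativeReductionAtPrime q →
      ¬ p ∣ padicValInt q W.minimalDiscriminantInt → IsErratumField W K q →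
      Cas20Standing K p (W.conductorNorm ℤ / p) →
      WeierstrassCurve.Affine.Point.map w₀.embedding.toRatAlgHom P = heegnerPointComplex Dt H →
      ¬ (p : ℤ) ∣ Dt.c → ¬ IsOfFinAddOrder P →
      ∀ (κ : ZpExtension K p), κ.IsAnticyclotomic →
        ∀ (γ : Field.absoluteGaloisGroup K) [Fact (κ.IsTopGenerator γ)] (ι' : PadicAlgCl p ≃+* ℂ)
          (e : K →+* ℚ_[p]),
          (∀ k : 𝓞 K, k ∈ (primeOfEmbeddingDatum p ι' w₀.embedding).asIdeal ↔ ‖e (k : K)‖ < 1) →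
          ∃ (ΩK : ℂ) (Ωp : ℂ_[p]), ΩK ≠ 0 ∧ Ωp ≠ 0 ∧
            ∀ (φ : ℕ → HeckeCharacter K) (n : ℕ → ℕ) (r : ℕ → FramedGaloisRep K (PadicAlgCl p) 1),
              (∀ k, 0 < n k) → (∀ k (v : HeightOneSpectrum (𝓞 K)), (φ k).IsUnramifiedAt v) →
              (∀ k, (φ k).HasInfinityType (fun _ ↦ (n k : ℤ)) (fun _ ↦ -(n k : ℤ))) →
              (∀ k, IsPAdicAvatarOf ι' (φ k) (r k)) → (∀ k, FactorsThroughZp κ (r k)) →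
              Tendsto (fun k ↦ avatarValueAt (r k) γ) atTop (𝓝 1) →
              Tendsto (fun k ↦ ‖((ι'.symm (bdpInterpolationValue p Dt.f
                  (primeOfEmbeddingDatum p ι' w₀.embedding) (φ k) (n k) ΩK) : PadicAlgCl p) : ℂ_[p]) *
                Ωp ^ (4 * n k)‖) atTop
                (𝓝 (‖algebraMap ℚ_[p] ℂ_[p] (((1 : ℚ_[p]) - ((W.LFunction p : ℤ) : ℚ_[p]) *
                  (p : ℚ_[p])⁻¹) * logOmega W p e P)‖ ^ 2)))
    (h : P2.IMCDivIntCoreFrameAtErratumData W p) : P2.IMCDivIntFrameAtErratumData W p := by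
  intro _ q _ K _ _ Dt H w₀ P hE hr hqp hmq hns hvq hK hCas hP hc hinf κ hκ γ hγ ι' e he
  obtain ⟨ΩK, Ωp, Q, hΩ, hΩp, hQ, hdiv⟩ :=
    h q K Dt H w₀ P hE hr hqp hmq hns hvq hK hCas hP hc hinf κ hκ γ ι' e he
  obtain ⟨ΩK', Ωp', hΩK', hΩp', hcont⟩ :=
    hVN q K Dt H w₀ P hE hr hqp hmq hns hvq hK hCas hP hc hinf κ hκ γ ι' e he
  have hp2 : p ≠ 2 := hE.two_ne
  have hΩp0 : Ωp ≠ 0 := by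
    intro h0
    rw [h0, norm_zero] at hΩp
    exact zero_ne_one hΩp
  have ha : W.LFunction p = 1 ∨ W.LFunction p = -1 :=
    Three.lFunction_eq_one_or_eq_neg_one_of_isNewformOf W Dt.isNewformOf hE.2.1
  set x : ℚ_[p] := ((1 : ℚ_[p]) - ((W.LFunction p : ℤ) : ℚ_[p]) * (p : ℚ_[p])⁻¹) * logOmega W p e P
    with hxdef
  have hp' : p.Prime := Fact.out
  have hx : x ≠ 0 := by
    refine mul_ne_zero ?_ (R1.logOmega_ne_zero W p e hinf)
    have hp0 : (p : ℚ_[p]) ≠ 0 := Nat.cast_ne_zero.mpr hp'.ne_zero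
    intro h0
    have h' : ((W.LFunction p : ℤ) : ℚ_[p]) = (p : ℚ_[p]) := by
      have := congrArg (· * (p : ℚ_[p])) h0
      simp only [sub_mul, one_mul, zero_mul, inv_mul_cancel_right₀ hp0, sub_eq_zero] at this
      exact this.symm
    have h'' : ((W.LFunction p : ℤ) : ℚ_[p]) = ((p : ℤ) : ℚ_[p]) := by rw [h']; norm_cast
    have haZ : (W.LFunction p : ℤ) = (p : ℤ) := Int.cast_injective h''
    have hp2' : (2 : ℤ) ≤ (p : ℤ) := by exact_mod_cast hp'.two_le
    rcases ha with ha | ha <;> rw [ha] at haZ <;> omega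
  set y : ℂ_[p] := algebraMap ℚ_[p] ℂ_[p] x with hydef
  have hy0 : y ≠ 0 := (map_ne_zero_iff _ (algebraMap ℚ_[p] ℂ_[p]).injective).mpr hx
  have hN0 : ‖y‖ ^ 2 ≠ 0 := pow_ne_zero _ (norm_ne_zero_iff.mpr hy0)
  have key := intSeries_norm_constantCoeff_eq_of_isBDPLFunctionInt_of_continuousNorms hp2 hK.1 hκ
    hγ.out hΩK' hΩ hΩp' hΩp0 hcont hN0 hQ
  refine ⟨ΩK, Ωp, Q, hΩ, hΩp, hQ, ?_, hdiv⟩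
  set c : ℂ_[p] := ((PowerSeries.constantCoeff Q : 𝓞_ℂ_[p]) : ℂ_[p]) with hcdef
  have hy2 : y ^ 2 ≠ 0 := pow_ne_zero _ hy0
  refine ⟨c / y ^ 2, ?_, ?_⟩
  · rw [norm_div, norm_pow, key, div_self hN0]
  · rw [div_mul_cancel₀ c hy2]
    exact R1.intSeries_hasValueAt_zero p Q

end Pair

/-! ### §2 Class level: the body of crux 19061 from print + H3♭ + REST‴ + ¬(ram) -/

/-- **KERNEL FORM OF «19061 from print» (planner D4's `<KERNEL_THM>`).** From the PUBLISHED (VN_p) fact,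
H3♭ at every pair (body of item 19270), the published ∕ cited facts (body of 19283), Wuthrich 2014 Prop. 21
(body of 19285), the PUBLISHED JSW17 control fact, REST‴ (imc-p1's residual: the (ram) pairs with NO odd
non-split `E[p]`-ramified witness or with `E(ℚ_p)[p] ≠ 0`) and the ¬(ram) input (body of 19282): the body
of crux 19061, `∀ W p, P2OpenInputOnTreeAt W p`. Case split per pair: ¬(ram) → `hOff`; (ram) without
erratum datum → `hrest`; (ram) with an odd non-split witness and (iv) → §1. Argument order as in
`plan/D4/Closes-D4-K2.template.lean`. CONDITIONAL on every hypothesis; nothing booked.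
[claim: Castella2018Erratum, status: under-review]
[cite: Castella2018Exceptional, Thms. 2.10–2.11 (arXiv:1507.04260 pp. 13–14)]
[cite: JetchevSkinnerWan2017, Thm. 3.3.1 with §3.5 (3.5.c) (arXiv:1512.06894 pp. 11, 15)]
[cite: Wuthrich2014, Prop. 21 (p. 400)] [cite: Miller2011LMS, Def. 1.1] -/
theorem openInputIMCBody_of_print_of_core_of_rest3_of_notRam
    (hVN : castella2018Exceptional_bdpValueContinuity_trivialChar)
    (h3 : ∀ (W : WeierstrassCurve ℚ) [W.IsElliptic] [W.IsGloballyMinimal] (p : ℕ) [Fact p.Prime],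
      P2.IMCDivIntCoreFrameAtErratumData W p)
    (hF : GrossZagier1986_thm_I_7_3 ∧ rank_eq_analyticRank_of_analyticRank_le_one ∧
      Skinner2016.thmC_padicValRat_bsd_rank_zero ∧ exists_isNewformOf ∧
      CaiShuTian2014.thm11_trivialChar ∧ friedbergHoffstein_exists_twist_ne_zero_ramifiedAt ∧
      mazur_not_dvd_maninConstant_of_odd ∧
      (∀ (N : ℕ) [NeZero N] (W : WeierstrassCurve ℚ) (K : Type) [Field K] [NumberField K],
        gross_zagier N W K) ∧
      (∀ (N : ℕ) [NeZero N] (W : WeierstrassCurve ℚ) (K : Type) [Field K] [NumberField K],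
        kolyvagin N W K) ∧
      (∀ (N : ℕ) [NeZero N] (W : WeierstrassCurve ℚ) (K : Type) [Field K] [NumberField K],
        Kolyvagin1990_padicValNat_card_sha_le N W K) ∧
      HoffsteinLuo1997_exists_twist_L_one_ne_zero ∧
      (∀ (K : Type) [Field K] [NumberField K], poitouTate_sum_localTatePairing_eq_zero K) ∧
      (∀ (K : Type) [Field K] [NumberField K], poitouTate_selmerStructure_duality K) ∧
      (∀ (K : Type) [Field K] [NumberField K], poitouTate_sha_tateDual K) ∧
      (∀ (K : Type) [Field K] [NumberField K] (v : HeightOneSpectrum (𝓞 K)),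
        localEulerPoincareCharacteristic (v.adicCompletion K)) ∧
      fieldCdLE_two_of_numberField)
    (hWu : sha_dvd_analyticSha) (h331 : thm331_anticyclotomicControl_mult)
    (hrest : ∀ (W : WeierstrassCurve ℚ) [W.IsElliptic] [W.IsGloballyMinimal] (p : ℕ) [Fact p.Prime],
      Ram W p →
      ¬ ((∃ (q : ℕ) (_ : Fact q.Prime), q ≠ 2 ∧ q ≠ p ∧ Mult W q ∧
            ¬ W.HasSplitMultiplicativeReductionAtPrime q ∧
            ¬ p ∣ padicValInt q W.minimalDiscriminantInt) ∧
          (∀ P : (W.baseChange ℚ_[p]).toAffine.Point, p • P = 0 → P = 0)) →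
      P2OpenInputOnTreeAt W p)
    (hOff : ∀ (W : WeierstrassCurve ℚ) [W.IsElliptic] [W.IsGloballyMinimal] (p : ℕ) [Fact p.Prime],
      ¬ Ram W p → P2OpenInputOnTreeAt W p) :
    ∀ (W : WeierstrassCurve ℚ) [W.IsElliptic] [W.IsGloballyMinimal] (p : ℕ) [Fact p.Prime],
      P2OpenInputOnTreeAt W p := by
  intro W _ _ p _
  obtain ⟨hGZ86, hGZK, hSk, hnf, hCST, hFH, hMaz, hGZ, hKo, -, -, hPTs, -, -, hEP, -⟩ := hF
  by_cases hram : Ram W p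
  · by_cases hw : (∃ (q : ℕ) (_ : Fact q.Prime), q ≠ 2 ∧ q ≠ p ∧ Mult W q ∧
        ¬ W.HasSplitMultiplicativeReductionAtPrime q ∧ ¬ p ∣ padicValInt q W.minimalDiscriminantInt) ∧
        (∀ P : (W.baseChange ℚ_[p]).toAffine.Point, p • P = 0 → P = 0)
    · obtain ⟨⟨q, hqF, hq2, hqp, hmq, hnsq, hvq⟩, htors⟩ := hw
      haveI := hqF
      refine p2OpenInputOnTreeAt_of_imp_surj W p fun hX hp5 _hs ↦ ?_
      have hr : W.analyticRank = 1 := hX.1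
      have hE : ErratumHypotheses W p := ⟨hp5, hX.2.2.1, hX.2.2.2, ⟨q, ‹_›, hqp, hmq, hnsq, hvq⟩, htors⟩
      -- (VN_p) at the erratum data of `(W, p)` from the published fact (binder bookkeeping)
      have hVNW : ∀ [NeZero (W.conductorNorm ℤ)] (q : ℕ) [Fact q.Prime] (K : Type) [Field K]
          [NumberField K] (Dt : ModularParametrizationData W (W.conductorNorm ℤ))
          (H : HeegnerDatum (W.conductorNorm ℤ) (NumberField.discr K)) (w₀ : InfinitePlace K)
          (P : (W.baseChange K).toAffine.Point), ErratumHypotheses W p → W.analyticRank = 1 →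
          q ≠ p → Mult W q → ¬ W.HasSplitMultiplicativeReductionAtPrime q →
          ¬ p ∣ padicValInt q W.minimalDiscriminantInt → IsErratumField W K q →
          Cas20Standing K p (W.conductorNorm ℤ / p) →
          WeierstrassCurve.Affine.Point.map w₀.embedding.toRatAlgHom P = heegnerPointComplex Dt H →
          ¬ (p : ℤ) ∣ Dt.c → ¬ IsOfFinAddOrder P →
          ∀ (κ : ZpExtension K p), κ.IsAnticyclotomic →
            ∀ (γ : Field.absoluteGaloisGroup K) [Fact (κ.IsTopGenerator γ)] (ι' : PadicAlgCl p ≃+* ℂ)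
              (e : K →+* ℚ_[p]),
              (∀ k : 𝓞 K, k ∈ (primeOfEmbeddingDatum p ι' w₀.embedding).asIdeal ↔ ‖e (k : K)‖ < 1) →
              ∃ (ΩK : ℂ) (Ωp : ℂ_[p]), ΩK ≠ 0 ∧ Ωp ≠ 0 ∧
                ∀ (φ : ℕ → HeckeCharacter K) (n : ℕ → ℕ)
                  (r : ℕ → FramedGaloisRep K (PadicAlgCl p) 1),
                  (∀ k, 0 < n k) → (∀ k (v : HeightOneSpectrum (𝓞 K)), (φ k).IsUnramifiedAt v) →
                  (∀ k, (φ k).HasInfinityType (fun _ ↦ (n k : ℤ)) (fun _ ↦ -(n k : ℤ))) →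
                  (∀ k, IsPAdicAvatarOf ι' (φ k) (r k)) → (∀ k, FactorsThroughZp κ (r k)) →
                  Tendsto (fun k ↦ avatarValueAt (r k) γ) atTop (𝓝 1) →
                  Tendsto (fun k ↦ ‖((ι'.symm (bdpInterpolationValue p Dt.f
                      (primeOfEmbeddingDatum p ι' w₀.embedding) (φ k) (n k) ΩK) : PadicAlgCl p) :
                      ℂ_[p]) * Ωp ^ (4 * n k)‖) atTop
                    (𝓝 (‖algebraMap ℚ_[p] ℂ_[p] (((1 : ℚ_[p]) - ((W.LFunction p : ℤ) : ℚ_[p]) *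
                      (p : ℚ_[p])⁻¹) * logOmega W p e P)‖ ^ 2)) := by
        intro _ q' _ K _ _ Dt H w₀ P hE' hr' hqp' hmq' hns' hvq' hK hCas hP hc hinf κ hκ γ hγ ι' e he
        have hpN : p ∣ W.conductorNorm ℤ := dvd_conductorNorm_of_mult hE'.2.1
        have hsign : ∀ (ℓ : ℕ) [Fact ℓ.Prime], ℓ ∣ W.conductorNorm ℤ → (ℓ : ℤ) ∣ NumberField.discr K →
            W.HasMultiplicativeReductionAtPrime ℓ ∧ ¬ W.HasSplitMultiplicativeReductionAtPrime ℓ := by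
          intro ℓ _ hℓN hℓD
          by_cases hℓq : ℓ = q'
          · subst hℓq
            exact ⟨hmq', hns'⟩
          · exact absurd hℓD
              (not_dvd_discr_of_splitsIn hK.1.1 Fact.out (hK.2.2.1 ℓ Fact.out hℓN hℓq))
        obtain ⟨ΩK, Ωp, u, hΩK, hΩp, hu, hcont⟩ :=
          hVN ι' W K (primeOfEmbeddingDatum p ι' w₀.embedding) κ γ Dt H w₀ e P hE'.1 rfl hE'.2.1 hK.1
            hCas.2.1 hCas.2.2.1 (hK.ncard_primesOver_eq_two Fact.out hpN hqp')
            (natCast_mem_primeOfEmbeddingDatum p ι' w₀.embedding)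
            (forall_mem_primeOfEmbeddingDatum_iff p ι' hK.1 w₀) (hK.forall_exists_absNorm_eq Fact.out)
            (fun ℓ _ hℓN hℓD ↦ hsign ℓ hℓN hℓD) hκ hγ.out hc hP he
        refine ⟨ΩK, Ωp, hΩK, hΩp, fun φ n r hn hunr hinf' hr'' hrκ hlim ↦ ?_⟩
        have h := (hcont φ n r hn hunr hinf' hr'' hrκ hlim).norm
        rw [norm_mul, hu, one_mul, norm_pow] at h
        rw [R1.logOmega_eq_padicLogOmega]
        exact h
      have hD : P2.IMCDivIntFrameAtErratumData W p :=
        imcDivIntFrameAtErratumData_of_normContinuity_of_core hVNW (h3 W p)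
      have hlow : Typed.MissingLowerBoundAt W p :=
        missingLowerBoundAt_of_erratumHypotheses_of_imcDivIntFrameAtErratumData W p hGZ86 hGZK hWu hnf
          hCST hFH hMaz hPTs hEP hD hE hq2 hqp hmq hnsq hvq hr
      exact openInputOnTreeAt_of_missingLowerBoundAt_of_ram W p hGZ hKo hSk hGZK
        (hasEntireLFunction_rat_of_exists_isNewformOf hnf)
        (p2ControlOnTreeAt_of_thm331Mult W p h331 hKo) hram hlow
    · exact hrest W p hram hw
  · exact hOff W p hram

/-- **The same with REST‴ spelled with an integer-cast valuation clause** (`¬ (p : ℤ) ∣ ↑(padicValInt q Δ_min)`,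
the spelling of `plan/D4/edit-D4-K2.json`'s `RamNoErratumDataAtFive`; equivalent by
`Int.natCast_dvd_natCast`). Bookkeeping. [folklore] -/
theorem openInputIMCBody_of_print_of_core_of_rest3_of_notRam_intCast
    (hVN : castella2018Exceptional_bdpValueContinuity_trivialChar)
    (h3 : ∀ (W : WeierstrassCurve ℚ) [W.IsElliptic] [W.IsGloballyMinimal] (p : ℕ) [Fact p.Prime],
      P2.IMCDivIntCoreFrameAtErratumData W p)
    (hF : GrossZagier1986_thm_I_7_3 ∧ rank_eq_analyticRank_of_analyticRank_le_one ∧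
      Skinner2016.thmC_padicValRat_bsd_rank_zero ∧ exists_isNewformOf ∧
      CaiShuTian2014.thm11_trivialChar ∧ friedbergHoffstein_exists_twist_ne_zero_ramifiedAt ∧
      mazur_not_dvd_maninConstant_of_odd ∧
      (∀ (N : ℕ) [NeZero N] (W : WeierstrassCurve ℚ) (K : Type) [Field K] [NumberField K],
        gross_zagier N W K) ∧
      (∀ (N : ℕ) [NeZero N] (W : WeierstrassCurve ℚ) (K : Type) [Field K] [NumberField K],
        kolyvagin N W K) ∧
      (∀ (N : ℕ) [NeZero N] (W : WeierstrassCurve ℚ) (K : Type) [Field K] [NumberField K],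
        Kolyvagin1990_padicValNat_card_sha_le N W K) ∧
      HoffsteinLuo1997_exists_twist_L_one_ne_zero ∧
      (∀ (K : Type) [Field K] [NumberField K], poitouTate_sum_localTatePairing_eq_zero K) ∧
      (∀ (K : Type) [Field K] [NumberField K], poitouTate_selmerStructure_duality K) ∧
      (∀ (K : Type) [Field K] [NumberField K], poitouTate_sha_tateDual K) ∧
      (∀ (K : Type) [Field K] [NumberField K] (v : HeightOneSpectrum (𝓞 K)),
        localEulerPoincareCharacteristic (v.adicCompletion K)) ∧
      fieldCdLE_two_of_numberField)
    (hWu : sha_dvd_analyticSha) (h331 : thm331_anticyclotomicControl_mult)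
    (hrest : ∀ (W : WeierstrassCurve ℚ) [W.IsElliptic] [W.IsGloballyMinimal] (p : ℕ) [Fact p.Prime],
      Ram W p →
      ¬ ((∃ (q : ℕ) (_ : Fact q.Prime), q ≠ 2 ∧ q ≠ p ∧ Mult W q ∧
            ¬ W.HasSplitMultiplicativeReductionAtPrime q ∧
            ¬ (p : ℤ) ∣ (padicValInt q W.minimalDiscriminantInt : ℤ)) ∧
          (∀ P : (W.baseChange ℚ_[p]).toAffine.Point, p • P = 0 → P = 0)) →
      P2OpenInputOnTreeAt W p)
    (hOff : ∀ (W : WeierstrassCurve ℚ) [W.IsElliptic] [W.IsGloballyMinimal] (p : ℕ) [Fact p.Prime],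
      ¬ Ram W p → P2OpenInputOnTreeAt W p) :
    ∀ (W : WeierstrassCurve ℚ) [W.IsElliptic] [W.IsGloballyMinimal] (p : ℕ) [Fact p.Prime],
      P2OpenInputOnTreeAt W p := by
  refine openInputIMCBody_of_print_of_core_of_rest3_of_notRam hVN h3 hF hWu h331 (fun W _ _ p _ hram hw ↦
    hrest W p hram fun hw' ↦ hw ?_) hOff
  obtain ⟨⟨q, hqF, hq2, hqp, hmq, hnsq, hvq⟩, htors⟩ := hw'
  refine ⟨⟨q, hqF, hq2, hqp, hmq, hnsq, fun hd ↦ hvq ?_⟩, htors⟩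
  exact_mod_cast hd

end Summit.BirchSwinnertonDyer.BirchSwinnertonDyer.Theorems.KernelFromPrint

end
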